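import Literature.AlgebraicGeometry.HodgeTheory.FermatLinearSubspaceComplexPoints
import Literature.AlgebraicGeometry.HodgeTheory.FermatEigenspaceRestriction
import Literature.AlgebraicGeometry.HodgeTheory.HolomorphicBundleChernCharacterProjectiveSpace
import Mathlib.RingTheory.RootsOfUnity.Complex
import HarnessLib

/-!
# The `m²` lines `x₀ = u x₁, x₂ = u' x₃` of the Fermat surface of degree `m`: classes, coordinates, skew lines

Family `hodge`, layer `Literature/AlgebraicGeometry/HodgeTheory`. For the Fermat surface
`X = X²ₘ = V₊(x₀ᵐ + x₁ᵐ + x₂ᵐ + x₃ᵐ) ⊂ ℙ³_ℂ` (`fermatHypersurface (2 * 1) m`) and roots `u, u'` of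
`-1` of order `m`, the line `L(u, u') : x₀ = u x₁, x₂ = u' x₃` lies on `X` (Shioda, Math. Ann. 245
(1979) §1: the linear subspaces `L` of the Fermat variety; Aoki, J. Math. Soc. Japan 39 (1987) Thm. 1-1;
for `m = 3` these are the 27 lines, Hartshorne V Ex. 4.16). This file sets them up for EVERY degree
`m`, as Shioda–Aoki linear subspaces `L_{σ₀,ε}` of the tree (`linearSubspaceEmb`,
`FermatLinearSubspaceClass`, pairing `σ₀ = (0 1)(2 3)`), generalising the degree-`3` file
`FermatCubicSurfaceLineClasses`:

* `FermatSurface.lineEmb m w hw : ℙ¹_ℂ ⟶ X²ₘ` (`w = (u, u')`, `wᵢᵐ = -1`), a closed immersion, and its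
  class `FermatSurface.lineClass m μ w hw hm = g_* 1 ∈ H²(X²ₘ(ℂ); ℂ)` (Gysin image, Fulton,
  *Young Tableaux* App. B (5));
* `FermatSurface.hypersurfacePoint_map_lineEmb`, `FermatSurface.pt_mem_range_lineEmb_iff` — the complex
  points of `L(u, u')` in coordinates: `[u y₀ : y₀ : u' y₁ : y₁]`, i.e. `z₀ = u z₁ ∧ z₂ = u' z₃`;
* `FermatSurface.map_lineEmb_lineClass_eq_zero` — **skew lines**: `g_{L'}^* cl(L) = 0` when `u ≠ v`
  and `u' ≠ v'` (`L(u,u') ∩ L(v,v') = ∅`; the class of `L` dies off `L`, Deligne Cor. 8.2.8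
  unconditional half);
Small definitions: `linePairing`, `lineEps`, `lineVec`, `lineEmb`, `lineClass`; no named facts.
Sequels: the plane sections `x_{2q} = v x_{2q+1}` (`FermatSurfacePlaneSections`), the `G`-equivariance
of the line classes and the non-vanishing of their `(a, -a, b, -b)`-components (Aoki Thm. 1-1 for
`r = 1`, the named fact `Shioda1979_lines_represent`).

## References

* [Shioda1979HodgeFermat] T. Shioda, The Hodge conjecture for Fermat varieties, Math. Ann. 245 (1979), §1.
* [Aoki1987] N. Aoki, Some new algebraic cycles on Fermat varieties, J. Math. Soc. Japan 39 (1987), Thm. 1-1.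
* [Hartshorne1977] R. Hartshorne, Algebraic Geometry (1977), V Ex. 4.16, II Example 7.1.1, II Ex. 3.12.
* [DeligneHodgeIII1974] P. Deligne, Théorie de Hodge III, Prop. 8.2.7, Cor. 8.2.8.
* [FultonYoungTableaux1997] W. Fulton, Young Tableaux, App. B §B.1 (5).
-/

noncomputable section

open scoped LinearAlgebra.Projectivization
open CategoryTheory AlgebraicGeometry MvPolynomial
open Literature.AlgebraicGeometry.Motives Literature.AlgebraicTopology.SingularHomology
open Literature.NumberTheory.Transcendental

namespace Literature.AlgebraicGeometry.HodgeTheory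

namespace FermatSurface

variable {m : ℕ}

/-! ### The pairing `(0 1)(2 3)` and the slope vectors -/

/-- The pairing `0 ↔ 1`, `2 ↔ 3` of the four homogeneous coordinates of `ℙ³` (a fixed-point-free
involution), whose linear subspaces `L_{σ₀,ε}` are the lines `x₀ = ε₀ x₁, x₂ = ε₂ x₃`.
[cite: Shioda1979HodgeFermat, §1] -/
def linePairing : Equiv.Perm (Fin (2 * 1 + 2)) :=
  Equiv.swap 0 1 * Equiv.swap 2 3

/-- `σ₀` has no fixed point. [folklore] -/
theorem linePairing_ne : ∀ i, linePairing i ≠ i := by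
  decide

/-- `σ₀` is an involution. [folklore] -/
theorem linePairing_linePairing : ∀ i, linePairing (linePairing i) = i := by
  decide

/-- The smaller elements of the two orbits of `σ₀` are `0` and `2`. [folklore] -/
theorem lt_linePairing_iff (i : Fin (2 * 1 + 2)) : i < linePairing i ↔ i = 0 ∨ i = 2 := by
  revert i
  decide

/-- `σ₀ 0 = 1`. [folklore] -/
theorem linePairing_zero : linePairing 0 = 1 := by
  decide

/-- `σ₀ 2 = 3`. [folklore] -/
theorem linePairing_two : linePairing 2 = 3 := by
  decide

/-- The slope vector `ε` of the line `x₀ = u x₁, x₂ = u' x₃` (`w = (u, u')`): `ε₀ = u`, `ε₂ = u'`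
(the values at the larger elements `1`, `3` are irrelevant and set to `1`). [cite: Shioda1979HodgeFermat, §1] -/
def lineEps (w : Fin 2 → ℂ) : Fin (2 * 1 + 2) → ℂ :=
  ![w 0, 1, w 1, 1]

/-- `ε₀ = u`. [folklore] -/
@[simp] theorem lineEps_zero (w : Fin 2 → ℂ) : lineEps w 0 = w 0 := rfl

/-- `ε₂ = u'`. [folklore] -/
@[simp] theorem lineEps_two (w : Fin 2 → ℂ) : lineEps w 2 = w 1 := rfl

/-- For roots `u, u'` of `-1`, `εᵢᵐ = -1` at the smaller elements. [folklore] -/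
theorem lineEps_pow {w : Fin 2 → ℂ} (hw : ∀ q, w q ^ m = -1) :
    ∀ i, i < linePairing i → lineEps w i ^ m = -1 := by
  intro i hi
  rcases (lt_linePairing_iff i).mp hi with rfl | rfl
  · rw [lineEps_zero]; exact hw 0
  · rw [lineEps_two]; exact hw 1

/-! ### The lines `L(u, u')` and their classes -/

/-- Local notation: the Fermat surface `X²ₘ = V₊(Σ xᵢᵐ) ⊂ ℙ³`. -/
local notation "X_" m => fermatHypersurface (2 * 1) m
/-- Local notation: the closed immersion `X²ₘ ↪ ℙ³`. -/
local notation "ιX" m => SmoothHypersurface.hypersurfaceι (fermatPolynomial ℂ (2 * 1) m)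

/-- `X²ₘ` is smooth projective of dimension `2` (`m ≥ 1`). [cite: Hartshorne1977, I Ex. 5.5] -/
theorem isSmoothProjective_X (hm : 1 ≤ m) : Motives.IsSmoothProjective (2 * 1) (X_ m) :=
  isSmoothProjective_fermatHypersurface (n := 2 * 1) (by norm_num) hm

/-- **The line `L(u, u') : x₀ = u x₁, x₂ = u' x₃` of the Fermat surface of degree `m`, as an
embedding `ℙ¹_ℂ ⟶ X²ₘ`** (`w = (u, u')`, `uᵐ = u'ᵐ = -1`) — Shioda's linear subspace `L_{σ₀,ε}`
(`linearSubspaceEmb`). [cite: Shioda1979HodgeFermat, §1] [cite: Aoki1987, Thm. 1-1] -/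
def lineEmb (m : ℕ) (w : Fin 2 → ℂ) (hw : ∀ q, w q ^ m = -1) : Motives.projectiveSpace 1 ℂ ⟶ X_ m :=
  linearSubspaceEmb m linePairing_ne linePairing_linePairing (lineEps w) (lineEps_pow hw)

/-- `L(u, u') ↪ X²ₘ` is a closed immersion. [cite: Hartshorne1977, II Ex. 3.12] -/
instance isClosedImmersion_lineEmb_left (m : ℕ) (w : Fin 2 → ℂ) (hw : ∀ q, w q ^ m = -1) :
    IsClosedImmersion (lineEmb m w hw).left :=
  isClosedImmersion_linearSubspaceEmb_left _ _ _ _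

/-- `L(u, u') ↪ X²ₘ ↪ ℙ³` is the linear map of the parametrisation. [folklore] -/
theorem lineEmb_comp_ι (m : ℕ) (w : Fin 2 → ℂ) (hw : ∀ q, w q ^ m = -1) :
    lineEmb m w hw ≫ (ιX m) = pairedLinEmb linePairing_ne linePairing_linePairing (lineEps w) :=
  linearSubspaceEmb_comp_ι _ _ _ _

/-- `L(u, u') ↪ X²ₘ ↪ ℙ³` is a closed immersion. [cite: Hartshorne1977, II Ex. 3.12] -/
instance isClosedImmersion_lineEmb_comp_ι_left (m : ℕ) (w : Fin 2 → ℂ) (hw : ∀ q, w q ^ m = -1) :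
    IsClosedImmersion (lineEmb m w hw ≫ (ιX m)).left := by
  rw [lineEmb_comp_ι]
  exact ProjectiveSpace.isClosedImmersion_linSubstMap_left _ _ _

variable (μ : OrientationFamily)

/-- **The class `cl(L(u, u')) = g_* 1 ∈ H²(X²ₘ(ℂ); ℂ)` of the line** (the Gysin image of
`1 ∈ H⁰(ℙ¹(ℂ))` relative to the orientation family `μ`; Shioda's `fermatLinearSubspaceClass` for
`r = 1`). [cite: Shioda1979HodgeFermat, §1] [cite: FultonYoungTableaux1997, Appendix B §B.1 (5)] -/
def lineClass (m : ℕ) (w : Fin 2 → ℂ) (hw : ∀ q, w q ^ m = -1) (hm : 1 ≤ m) :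
    complexBetti (X_ m) (2 * 1) :=
  complexGysin μ (isSmoothProjective_projectiveSpace' 1) (isSmoothProjective_X hm) (lineEmb m w hw)
    (show 0 + 2 * (2 * 1) = 2 * 1 + 2 * 1 by ring)
    (singularCohomology.one ℂ (Motives.ComplexPoints (Motives.projectiveSpace 1 ℂ)))

/-- `cl(L)` is the tree's `fermatLinearSubspaceClass` of `L_{σ₀,ε}` (`rfl`). [folklore] -/
theorem lineClass_eq_fermatLinearSubspaceClass (m : ℕ) (w : Fin 2 → ℂ) (hw : ∀ q, w q ^ m = -1)
    (hm : 1 ≤ m) :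
    lineClass μ m w hw hm = fermatLinearSubspaceClass m μ linePairing_ne linePairing_linePairing
      (lineEps w) (lineEps_pow hw) le_rfl hm :=
  rfl

/-! ### Complex points of the lines in coordinates -/

/-- The numbering of the smaller elements of `σ₀`: `e 0 = 0`. [folklore] -/
theorem orderEmbOfFin_linePairing_zero :
    Finset.orderEmbOfFin _ (card_filter_lt_perm linePairing_ne linePairing_linePairing) 0 = 0 := by
  have hcard := card_filter_lt_perm linePairing_ne linePairing_linePairing
  obtain ⟨j, hj⟩ : (0 : Fin (2 * 1 + 2)) ∈ Set.range (Finset.orderEmbOfFin _ hcard) := by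
    rw [Finset.range_orderEmbOfFin, Finset.mem_coe]
    simpa using (lt_linePairing_iff 0).mpr (Or.inl rfl)
  exact le_antisymm (((Finset.orderEmbOfFin _ hcard).monotone (Fin.zero_le j)).trans hj.le)
    (Fin.zero_le _)

/-- `[0] = 0`: the orbit of `0` is the first one. [folklore] -/
theorem pairOrbitIndex_linePairing_zero : pairOrbitIndex linePairing 0 = 0 := by
  have h := orderEmbOfFin_pairOrbitIndex linePairing_ne linePairing_linePairing
    ((lt_linePairing_iff 0).mpr (Or.inl rfl))
  conv_rhs at h => rw [← orderEmbOfFin_linePairing_zero]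
  exact (Finset.orderEmbOfFin _ _).injective h

/-- `[2] = 1`: the orbit of `2` is the second one. [folklore] -/
theorem pairOrbitIndex_linePairing_two : pairOrbitIndex linePairing 2 = 1 := by
  have hK := orderEmbOfFin_pairOrbitIndex linePairing_ne linePairing_linePairing
    ((lt_linePairing_iff 2).mpr (Or.inr rfl))
  have hne : pairOrbitIndex linePairing 2 ≠ 0 := by
    intro h0
    rw [h0, orderEmbOfFin_linePairing_zero] at hK
    revert hK
    decide
  exact Fin.eq_one_of_ne_zero _ hne

/-- The homogeneous coordinates `(u y₀, y₀, u' y₁, y₁)` of the point of parameter `[y₀ : y₁]` on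
`L(u, u')`. [cite: Shioda1979HodgeFermat, §1] -/
def lineVec (w : Fin 2 → ℂ) (y : Fin (1 + 1) → ℂ) : Fin (2 * 1 + 2) → ℂ :=
  ![w 0 * y 0, y 0, w 1 * y 1, y 1]

/-- Case analysis on the four homogeneous coordinates of `ℙ³`. [folklore] -/
theorem forall_fin_four {P : Fin (2 * 1 + 2) → Prop} (h0 : P 0) (h1 : P 1) (h2 : P 2) (h3 : P 3) :
    ∀ i, P i := by
  intro i
  match i with
  | ⟨0, _⟩ => exact h0
  | ⟨1, _⟩ => exact h1
  | ⟨2, _⟩ => exact h2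
  | ⟨3, _⟩ => exact h3
  | ⟨k + 4, hk⟩ => exact absurd hk (by omega)

/-- The parametrising substitution of `L_{σ₀,ε}` evaluated at `y` is `lineVec w y`. [folklore] -/
theorem aeval_pairedSubst_lineEps (w : Fin 2 → ℂ) (y : Fin (1 + 1) → ℂ) (i : Fin (2 * 1 + 2)) :
    aeval y (pairedSubst linePairing (lineEps w) i) = lineVec w y i := by
  have h0 : (0 : Fin (2 * 1 + 2)) < linePairing 0 := (lt_linePairing_iff 0).mpr (Or.inl rfl)
  have h2 : (2 : Fin (2 * 1 + 2)) < linePairing 2 := (lt_linePairing_iff 2).mpr (Or.inr rfl)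
  have e0 : aeval y (pairedSubst linePairing (lineEps w) 0) = lineVec w y 0 := by
    rw [aeval_pairedSubst_of_lt _ _ h0, pairOrbitIndex_linePairing_zero, lineEps_zero]
    rfl
  have e1 : aeval y (pairedSubst linePairing (lineEps w) 1) = lineVec w y 1 := by
    have h := aeval_pairedSubst_perm linePairing_linePairing (lineEps w) y h0
    rw [linePairing_zero, pairOrbitIndex_linePairing_zero] at h
    exact h
  have e2 : aeval y (pairedSubst linePairing (lineEps w) 2) = lineVec w y 2 := by
    rw [aeval_pairedSubst_of_lt _ _ h2, pairOrbitIndex_linePairing_two, lineEps_two]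
    rfl
  have e3 : aeval y (pairedSubst linePairing (lineEps w) 3) = lineVec w y 3 := by
    have h := aeval_pairedSubst_perm linePairing_linePairing (lineEps w) y h2
    rw [linePairing_two, pairOrbitIndex_linePairing_two] at h
    exact h
  exact forall_fin_four (P := fun i ↦ aeval y (pairedSubst linePairing (lineEps w) i) = lineVec w y i)
    e0 e1 e2 e3 i

/-- `lineVec w y ≠ 0` for `y ≠ 0`. [folklore] -/
theorem lineVec_ne_zero (w : Fin 2 → ℂ) {y : Fin (1 + 1) → ℂ} (hy : y ≠ 0) : lineVec w y ≠ 0 := by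
  have h := ProjectiveSpace.linSubstVec_ne_zero (pairedSubst linePairing (lineEps w))
    (exists_pairedSubst_eq_X linePairing_ne linePairing_linePairing (lineEps w)) hy
  rwa [show (fun i ↦ aeval y (pairedSubst linePairing (lineEps w) i)) = lineVec w y from
    _root_.funext (aeval_pairedSubst_lineEps w y)] at h

/-- **The homogeneous coordinates of `g([y])` are `[u y₀ : y₀ : u' y₁ : y₁]`.** [cite: Shioda1979HodgeFermat, §1] -/
theorem hypersurfacePoint_map_lineEmb (w : Fin 2 → ℂ) (hw : ∀ q, w q ^ m = -1)
    (y : Fin (1 + 1) → ℂ) (hy : y ≠ 0) :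
    hypersurfacePoint (ιX m) (AlgPoints.map (lineEmb m w hw) (projPoint 1 (Projectivization.mk ℂ y hy))) =
      Projectivization.mk ℂ (lineVec w y) (lineVec_ne_zero w hy) := by
  rw [lineEmb, hypersurfacePoint_map_linearSubspaceEmb]
  exact (Projectivization.mk_eq_mk_iff' ℂ _ _ _ _).mpr
    ⟨1, by rw [one_smul]; exact (_root_.funext (aeval_pairedSubst_lineEps w y)).symm⟩

/-- **A complex point `P = [z]` of `X²ₘ` lies on `L(u, u')` iff `z₀ = u z₁` and `z₂ = u' z₃`.**
[cite: Shioda1979HodgeFermat, §1] -/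
theorem pt_mem_range_lineEmb_iff (w : Fin 2 → ℂ) (hw : ∀ q, w q ^ m = -1)
    (P : ComplexPoints (X_ m)) {z : Fin (2 * 1 + 2) → ℂ} (hz : z ≠ 0)
    (hP : hypersurfacePoint (ιX m) P = Projectivization.mk ℂ z hz) :
    P.pt ∈ Set.range (lineEmb m w hw).left.base ↔ z 0 = w 0 * z 1 ∧ z 2 = w 1 * z 3 := by
  rw [lineEmb, pt_mem_range_linearSubspaceEmb_iff _ _ _ _ P hz hP]
  constructor
  · intro h
    refine ⟨?_, ?_⟩
    · have h0 := h 0 ((lt_linePairing_iff 0).mpr (Or.inl rfl))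
      rwa [linePairing_zero, lineEps_zero] at h0
    · have h2 := h 2 ((lt_linePairing_iff 2).mpr (Or.inr rfl))
      rwa [linePairing_two, lineEps_two] at h2
  · rintro ⟨h0, h2⟩ i hi
    rcases (lt_linePairing_iff i).mp hi with rfl | rfl
    · rwa [linePairing_zero, lineEps_zero]
    · rwa [linePairing_two, lineEps_two]

/-- The same for the chosen representative `z = rep (pt P)`. [cite: Shioda1979HodgeFermat, §1] -/
theorem pt_mem_range_lineEmb_iff_rep (w : Fin 2 → ℂ) (hw : ∀ q, w q ^ m = -1)
    (P : ComplexPoints (X_ m)) :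
    P.pt ∈ Set.range (lineEmb m w hw).left.base ↔
      (hypersurfacePoint (ιX m) P).rep 0 = w 0 * (hypersurfacePoint (ιX m) P).rep 1 ∧
        (hypersurfacePoint (ιX m) P).rep 2 = w 1 * (hypersurfacePoint (ιX m) P).rep 3 :=
  pt_mem_range_lineEmb_iff w hw P (Projectivization.rep_nonzero _) (Projectivization.mk_rep _).symm

/-! ### Skew lines: `g_{L'}^* cl(L) = 0` -/

/-- The class of a line dies off the line. [cite: DeligneHodgeIII1974, Cor. 8.2.8] -/
theorem restrictCompl_range_lineClass (w : Fin 2 → ℂ) (hw : ∀ q, w q ^ m = -1) (hm : 1 ≤ m) :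
    complexBetti.restrictCompl (X_ m) (Set.range (lineEmb m w hw).left.base) (2 * 1)
      (lineClass μ m w hw hm) = 0 := by
  have key := iSup_range_complexGysin_le_ker_restrictCompl' μ (isSmoothProjective_X hm) (ι := Unit)
    (m := fun _ ↦ 1) (Y := fun _ ↦ Motives.projectiveSpace 1 ℂ) (fun _ ↦ isSmoothProjective_projectiveSpace' 1)
    (fun _ ↦ lineEmb m w hw) (2 * 1)
  have hmem : lineClass μ m w hw hm ∈ LinearMap.ker (complexBetti.restrictCompl (X_ m)
      (⋃ _ : Unit, Set.range (lineEmb m w hw).left.base) (2 * 1)).hom :=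
    key (Submodule.mem_iSup_of_mem () (Submodule.mem_iSup_of_mem 0
      (Submodule.mem_iSup_of_mem (show 0 + 2 * (2 * 1) = 2 * 1 + 2 * 1 by ring) ⟨_, rfl⟩)))
  rw [Set.iUnion_const] at hmem
  exact LinearMap.mem_ker.mp hmem

/-- **Skew lines: `g_{L(v,v')}^* cl(L(u,u')) = 0` for `u ≠ v`, `u' ≠ v'`** — the two lines are
disjoint (a common point `[z]` has `z₁ (u - v) = 0 = z₃ (u' - v')`, hence `z = 0`), the class of
`L(u,u')` dies off `L(u,u')`, and `L(v,v')` avoids it ("`L · L' = 0` for skew lines").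
[cite: Hartshorne1977, V Ex. 4.16] [cite: DeligneHodgeIII1974, Cor. 8.2.8] -/
theorem map_lineEmb_lineClass_eq_zero {w w' : Fin 2 → ℂ} (hw : ∀ q, w q ^ m = -1)
    (hw' : ∀ q, w' q ^ m = -1) (hm : 1 ≤ m) (h0 : w 0 ≠ w' 0) (h1 : w 1 ≠ w' 1) :
    complexBetti.map (lineEmb m w' hw') (2 * 1) (lineClass μ m w hw hm) = 0 := by
  refine complexBetti_map_eq_zero_of_restrictCompl_eq_zero (lineEmb m w' hw')
    (S := Set.range (lineEmb m w hw).left.base) (fun Q hQ ↦ ?_) (restrictCompl_range_lineClass μ w hw hm)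
  have hq : (AlgPoints.map (lineEmb m w' hw') Q).pt ∈ Set.range (lineEmb m w' hw').left.base :=
    ⟨Q.pt, rfl⟩
  rw [pt_mem_range_lineEmb_iff_rep] at hQ hq
  set z := (hypersurfacePoint (ιX m) (AlgPoints.map (lineEmb m w' hw') Q)).rep with hz
  have hz1 : z 1 = 0 := by
    have h : (w 0 - w' 0) * z 1 = 0 := by rw [sub_mul, ← hQ.1, ← hq.1, sub_self]
    exact (mul_eq_zero.mp h).resolve_left (sub_ne_zero.mpr h0)
  have hz3 : z 3 = 0 := by
    have h : (w 1 - w' 1) * z 3 = 0 := by rw [sub_mul, ← hQ.2, ← hq.2, sub_self]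
    exact (mul_eq_zero.mp h).resolve_left (sub_ne_zero.mpr h1)
  have hz0 : z 0 = 0 := by rw [hQ.1, hz1, mul_zero]
  have hz2 : z 2 = 0 := by rw [hQ.2, hz3, mul_zero]
  exact Projectivization.rep_nonzero _ (_root_.funext
    (forall_fin_four (P := fun i ↦ z i = (0 : Fin (2 * 1 + 2) → ℂ) i) hz0 hz1 hz2 hz3))

end FermatSurface

end Literature.AlgebraicGeometry.HodgeTheory

end
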